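import Summits.QuantumFields.BalabanUV.T4Continuum.Support.NE7SlicedCoarseCurlLowerBound
import Summits.QuantumFields.BalabanUV.T4Continuum.Support.NE7SliceRepFibrePoincare
import HarnessLib

/-!
# NE7CoarseCurlFrameLetter — F9 WITH A FRAME LETTER IN PLACE OF FRAME-FREENESS: the frame commutator of gen 117's F6∕F7 is `O(δ_{V₀})` × the accumulated frame, pointwise —
# `nhsNormSq (frameComm) ≤ 4δ²·‖framePotW L (j+1) U X̃ z‖²` — so for ANY representative with a displayed frame mass `Φ ≥ Σ_{z∈periodBox N} ‖framePotW L (j+1) U X̃ z‖²`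
# (not necessarily frame-free: e.g. row NE7b's hierarchical representative, whose Whitney-type lifts keep their frames) the coarse Maxwell energy of the datum obeys
# `√(Σ_P nhs(curl_{V₀}ṽ)) ≤ √((1+θ)·hess + K·η²·dirSq X̃) + 4√#planes·ε·√Φ` (d = 4, j-UNIFORM; `δ_{V₀} ≤ 2ε` by ✓ `NE7RadIterUniform`), and with the scaled-mass Poincaré letter `hP` of F9:
# `Σ_P nhs(curl_{V₀}ṽ) ≤ (1+θ′)·(((1+θ) + 2K·C_P)·hess + 2K·R) + (1+θ′⁻¹)·16·#planes·ε²·Φ` (lineage `b2b-balaban-t4-ne7-p1`, gen 118, file G9; memo ROAD-G118 §3(d) — row NE7b g162's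
# request «`hff` must be weakened to a frame LETTER» for the hierarchical representative)

Cell `pub-balaban`, rung (B)+1 sub-cell t4, CRUX PROVER NE7 #1 (OWNER of row NE7), generation 118.  Inputs BY NAME: gen 117's F7 ✓ `NE7HessDominatesCoarseCurl.frameCorrected_coarse_curl_le_hess`,
`hess_self_ge_nhs`, `sum_bondSq_perWin_le`, `sq_of_sqrt_le_add`; F6's `frameComm`; ✓ `AveragingDeficitNearIdentity.norm_Ad_sub_le`; ✓ `AveragingDeficitMultiLevelPrep.cavgIter_unitary_small`;
✓ `NE7RadIterUniform.levelSmall_of_class_radius` (`radIter (j+1) (ε·L^{−2(j+1)}) ≤ 2ε`); ✓ `NE7QbarMassLetter.sqrt_sum_nhsNormSq_add_le` (Minkowski).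
WHAT ([folklore]; 0 def, 0 sorry): §1 `nhsNormSq_frameComm_le` (general d), `sum_nhsNormSq_frameComm_le` (general d: `Σ_{perWin N} ≤ 4·#planes·δ²·Σ_{periodBox N}‖G z‖²`);
§2 (d = 4) **`sqrt_coarse_curl_le_of_frameLetter`** (root form), **`coarse_curl_le_of_frameLetter`** (squared, Peter–Paul `θ′`), and **`coarse_curl_le_hess_of_frameLetter_poincare`** (F9's
statement with `hff` replaced by the frame letter `Φ`: the extra term `(1+θ′⁻¹)·16·#planes·ε²·Φ`; for a lift of a coarse datum `v` one expects `Φ = O(‖v‖²)`, i.e. an `O(ε²)‖v‖²` addition).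
HONEST FRAMING: algebra over landed kernel theorems about OUR objects; `Φ`, `C_P`, `R` are displayed letters of the representative; nothing of Bałaban's asserted ([Balaban1985Averaging] (48),
(110)–(120) context); NOT (G′), NOT NE7 as a spine node, NOT NE3; spine 0∕9; finite T⁴ rung (B)+1 — NOT infinite volume, NOT mass gap, NOT BetaPertH, NOT Clay.
-/

set_option autoImplicit false

open scoped BigOperators Matrix Matrix.Norms.L2Operator
open NormedSpace Finset

namespace Summit.QuantumFields.BalabanUV.T4Continuum.NE7CoarseCurlFrameLetter

open Literature.MathematicalPhysics.QuantumFieldTheory.Balaban1983to89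
open B7Prop1Explicit B7Prop2Explicit MatrixLog UnitaryModel
open T4AveragingDeficitWall (IsUnitaryCfg IsSkewDir SmallField Ad curl curlAt dirSq)
open T4AveragingDeficitWallBoundary (IsPeriodicCfg periodBox)
open AveragingDeficitPeriodicCounting (IsPeriodicDir)
open AveragingDeficitTorusChart (TDir chartDir isPeriodicDir_chartDir)
open AveragingDeficitNearIdentity (norm_Ad_sub_le)
open AveragingDeficitTwoLevelPrep (twoLevelSmall skewSub)
open AveragingDeficitMultiLevelPrep (cavgIter tower levelQ' tower_ne_zero radIter LevelSmall cavgIter_unitary_small)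
open MatrixNorms (nhsNormSq nhsNormSq_nonneg nhsNormSq_le_opNorm_sq)
open MinimalActionLevels (perWin)
open NE3HessForm (hess)
open NE3HessBounds (bondSq)
open NE3TangentCovariantTower (framePotW)
open NE3EnergyHessContTwoTerm (dirSq_nonneg)
open NE7RadIterUniform (radD levelSmall_of_class_radius)
open NE7StraightTowerCurlEnergy (eC mC eC_nonneg)
open NE7FrameCorrectedCurlEnergyTower (frameComm)
open NE7HessDominatesCoarseCurl (frameCorrected_coarse_curl_le_hess hess_self_ge_nhs sum_bondSq_perWin_le sq_of_sqrt_le_add)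
open NE7FlatAverageCurlCommutation (isSkewDir_chartDir_id)
open NE7QbarMassLetter (sqrt_sum_nhsNormSq_add_le)

noncomputable section

variable {d : ℕ} {n : Type*} [Fintype n] [DecidableEq n]

/-! ## §1 The frame commutator is `O(δ)` × the accumulated frame -/

/-- **`nhsNormSq (frameComm L j U Y z μ ν) ≤ 4δ²·‖framePotW L (j+1) U Y z‖²`** for `V₀ = cavgIter L (j+1) U` unitary with `SmallField V₀ δ` and `μ ≠ ν` (‖·‖² ≤ |·|², `|Ad_h G − G| ≤ 2|h − 1||G|`).
[folklore] -/
theorem nhsNormSq_frameComm_le [Nonempty n] {L j : ℕ} {U : Site d → Fin d → (Matrix n n ℂ)ˣ} {δ : ℝ} (hV : IsUnitaryCfg (cavgIter L (j + 1) U))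
    (hVδ : SmallField (cavgIter L (j + 1) U) δ) (Y : Site d → Fin d → Matrix n n ℂ) (z : Site d) {μ ν : Fin d} (hμν : μ ≠ ν) :
    nhsNormSq (frameComm L j U Y z μ ν) ≤ 4 * δ ^ 2 * ‖framePotW L (j + 1) U Y z‖ ^ 2 := by
  have hh : hol (cavgIter L (j + 1) U) z (plaqWord μ ν) ∈ unitaryUnits (Matrix n n ℂ) := hol_mem_of hV _ _
  have hδ := hVδ z μ ν hμν
  have h1 : ‖frameComm L j U Y z μ ν‖ ≤ 2 * δ * ‖framePotW L (j + 1) U Y z‖ := by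
    unfold NE7FrameCorrectedCurlEnergyTower.frameComm
    rw [← norm_neg, neg_sub]
    refine (norm_Ad_sub_le hh _).trans ?_
    have hG := norm_nonneg (framePotW L (j + 1) U Y z)
    nlinarith [norm_nonneg (((hol (cavgIter L (j + 1) U) z (plaqWord μ ν) : (Matrix n n ℂ)ˣ) : Matrix n n ℂ) - 1)]
  have h0 : 0 ≤ ‖frameComm L j U Y z μ ν‖ := norm_nonneg _
  calc nhsNormSq (frameComm L j U Y z μ ν) ≤ ‖frameComm L j U Y z μ ν‖ ^ 2 := nhsNormSq_le_opNorm_sq _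
    _ ≤ (2 * δ * ‖framePotW L (j + 1) U Y z‖) ^ 2 := pow_le_pow_left₀ h0 h1 2
    _ = 4 * δ ^ 2 * ‖framePotW L (j + 1) U Y z‖ ^ 2 := by ring

/-- **OVER THE PERIOD WINDOW**: `Σ_{P∈perWin d N} nhsNormSq (frameComm P) ≤ 4·#planes·δ²·Σ_{z∈periodBox N} ‖framePotW L (j+1) U Y z‖²`. [folklore] -/
theorem sum_nhsNormSq_frameComm_le [Nonempty n] {L j : ℕ} {U : Site d → Fin d → (Matrix n n ℂ)ˣ} {δ : ℝ} (hV : IsUnitaryCfg (cavgIter L (j + 1) U))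
    (hVδ : SmallField (cavgIter L (j + 1) U) δ) (Y : Site d → Fin d → Matrix n n ℂ) (N : ℕ) :
    ∑ P ∈ perWin d N, nhsNormSq (frameComm L j U Y P.1 P.2.1.1 P.2.1.2)
      ≤ 4 * (Fintype.card (T4AveragingDeficitWall.Plane d) : ℝ) * δ ^ 2 * ∑ z ∈ periodBox N, ‖framePotW L (j + 1) U Y z‖ ^ 2 := by
  rw [perWin, Finset.sum_product, Finset.mul_sum]
  refine Finset.sum_le_sum fun z _ => ?_
  calc ∑ π : T4AveragingDeficitWall.Plane d, nhsNormSq (frameComm L j U Y (z, π).1 (z, π).2.1.1 (z, π).2.1.2)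
      ≤ ∑ _π : T4AveragingDeficitWall.Plane d, 4 * δ ^ 2 * ‖framePotW L (j + 1) U Y z‖ ^ 2 :=
        Finset.sum_le_sum fun π _ => nhsNormSq_frameComm_le hV hVδ Y z (ne_of_lt π.2)
    _ = 4 * (Fintype.card (T4AveragingDeficitWall.Plane d) : ℝ) * δ ^ 2 * ‖framePotW L (j + 1) U Y z‖ ^ 2 := by
        rw [Finset.sum_const, Finset.card_univ, nsmul_eq_mul]; ring

/-! ## §2 F9 with a frame letter (`d = 4`) -/

/-- **ROOT FORM**: hypotheses of F7 ✓ `frameCorrected_coarse_curl_le_hess` and a frame letter `Σ_{z∈periodBox N} ‖framePotW L (j+1) U X̃ z‖² ≤ Φ`; then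
`√(Σ_{P∈perWin N} nhsNormSq (curl V₀ ṽ P)) ≤ √((1+θ)·hess U X̃ X̃ (perWin 4 (tower L N (j+1))) + K·(L⁻¹)^{2(j+1)}·dirSq X̃ (periodBox (tower L N (j+1)))) + 4·√#planes·ε·√Φ`,
`K = (1+θ)·14·#planes·ε + (1+θ⁻¹)·36·eC²·ε²` (the top background has plaquette radius `≤ 2ε`). [cite: Balaban1985Averaging, (48) p.25, (120) p.35] -/
theorem sqrt_coarse_curl_le_of_frameLetter [Nonempty n] {L N : ℕ} [NeZero L] [NeZero N] (hL : 2 ≤ L) (hN : 1 ≤ N) {ε : ℝ} (hε : 0 ≤ ε)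
    (hεD : 4 * ε * radD 4 L * (((L : ℝ) ^ 2)⁻¹) ^ 2 ≤ 1) (hεT : twoLevelSmall 4 L * (2 * ε * ((L : ℝ) ^ 2)⁻¹) ≤ 1)
    (hεM : 8 * (L : ℝ) * mC 4 L (Fintype.card n) * ε * ((L : ℝ) ^ 2)⁻¹ ≤ 1) (j : ℕ)
    {U : Site 4 → Fin 4 → (Matrix n n ℂ)ˣ} (hU : IsUnitaryCfg U) (hUP : IsPeriodicCfg U ((tower L N (j + 1) : ℕ) : ℤ))
    (hUx : SmallField U (ε * (((L : ℝ) ^ 2)⁻¹) ^ (j + 1)))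
    {X : TDir 4 n (L * tower L N j)} (hX : X ∈ skewSub 4 n (L * tower L N j)) {Φ : ℝ}
    (hΦ : ∑ z ∈ periodBox N, ‖framePotW L (j + 1) U (chartDir (ContinuousLinearMap.id ℝ (Matrix n n ℂ)) (L * tower L N j) X) z‖ ^ 2 ≤ Φ) {θ : ℝ} (hθ : 0 < θ) :
    Real.sqrt (∑ P ∈ perWin 4 N, nhsNormSq
        (curl (cavgIter L (j + 1) U) (chartDir (ContinuousLinearMap.id ℝ (Matrix n n ℂ)) N ((levelQ' L N j U X : ↥(skewSub 4 n N)) : TDir 4 n N)) P))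
      ≤ Real.sqrt ((1 + θ) * hess U (chartDir (ContinuousLinearMap.id ℝ (Matrix n n ℂ)) (L * tower L N j) X) (chartDir (ContinuousLinearMap.id ℝ (Matrix n n ℂ)) (L * tower L N j) X)
              (perWin 4 (tower L N (j + 1)))
          + ((1 + θ) * (14 * (Fintype.card (T4AveragingDeficitWall.Plane 4) : ℝ) * ε) + (1 + θ⁻¹) * (36 * eC 4 L (Fintype.card n) ^ 2 * ε ^ 2))
            * ((L : ℝ)⁻¹) ^ (2 * (j + 1)) * dirSq (chartDir (ContinuousLinearMap.id ℝ (Matrix n n ℂ)) (L * tower L N j) X) (periodBox (tower L N (j + 1))))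
        + 4 * Real.sqrt (Fintype.card (T4AveragingDeficitWall.Plane 4)) * ε * Real.sqrt Φ := by
  have hL1 : 1 ≤ L := by omega
  obtain ⟨hs, hrad⟩ := levelSmall_of_class_radius (d := 4) hL hε hεD hεT j
  have hx : 0 ≤ ε * (((L : ℝ) ^ 2)⁻¹) ^ (j + 1) := by positivity
  obtain ⟨hVu, hr0, hVr⟩ := cavgIter_unitary_small hL1 j hU hx hs hUx
  have hδ : radIter 4 L (j + 1) (ε * (((L : ℝ) ^ 2)⁻¹) ^ (j + 1)) ≤ 2 * ε := by
    have h := hrad (j + 1) le_rfl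
    rw [Nat.sub_self, pow_zero, mul_one] at h
    exact h
  set Xt := chartDir (ContinuousLinearMap.id ℝ (Matrix n n ℂ)) (L * tower L N j) X with hXt
  set vt := chartDir (ContinuousLinearMap.id ℝ (Matrix n n ℂ)) N ((levelQ' L N j U X : ↥(skewSub 4 n N)) : TDir 4 n N) with hvt
  -- F7 (frame-corrected) and the frame letter
  have hF7 := frameCorrected_coarse_curl_le_hess hL hN hε hεD hεT hεM j hU hUP hUx hX hθ
  have hfr := sum_nhsNormSq_frameComm_le (d := 4) hVu hVr Xt N
  -- Minkowski: curl ṽ = (curl ṽ − frameComm) + frameComm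
  have hM := sqrt_sum_nhsNormSq_add_le (perWin 4 N)
    (fun P => curl (cavgIter L (j + 1) U) vt P - frameComm L j U Xt P.1 P.2.1.1 P.2.1.2) (fun P => frameComm L j U Xt P.1 P.2.1.1 P.2.1.2)
  simp only [sub_add_cancel] at hM
  refine hM.trans (add_le_add (Real.sqrt_le_sqrt hF7) ?_)
  -- the frame part
  have hPl0 : (0 : ℝ) ≤ Fintype.card (T4AveragingDeficitWall.Plane 4) := Nat.cast_nonneg _
  have hΦ0 : 0 ≤ Φ := le_trans (Finset.sum_nonneg fun _ _ => sq_nonneg _) hΦ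
  have hb : ∑ P ∈ perWin 4 N, nhsNormSq (frameComm L j U Xt P.1 P.2.1.1 P.2.1.2)
      ≤ (4 * Real.sqrt (Fintype.card (T4AveragingDeficitWall.Plane 4)) * ε * Real.sqrt Φ) ^ 2 := by
    refine hfr.trans ?_
    have e : (4 * Real.sqrt (Fintype.card (T4AveragingDeficitWall.Plane 4)) * ε * Real.sqrt Φ) ^ 2
        = 16 * (Fintype.card (T4AveragingDeficitWall.Plane 4) : ℝ) * ε ^ 2 * Φ := by
      rw [mul_pow, mul_pow, mul_pow, Real.sq_sqrt hPl0, Real.sq_sqrt hΦ0]; ring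
    rw [e]
    have h1 : radIter 4 L (j + 1) (ε * (((L : ℝ) ^ 2)⁻¹) ^ (j + 1)) ^ 2 ≤ (2 * ε) ^ 2 := pow_le_pow_left₀ hr0 hδ 2
    have h2 : 0 ≤ ∑ z ∈ periodBox N, ‖framePotW L (j + 1) U Xt z‖ ^ 2 := Finset.sum_nonneg fun _ _ => sq_nonneg _
    calc 4 * (Fintype.card (T4AveragingDeficitWall.Plane 4) : ℝ) * radIter 4 L (j + 1) (ε * (((L : ℝ) ^ 2)⁻¹) ^ (j + 1)) ^ 2
          * ∑ z ∈ periodBox N, ‖framePotW L (j + 1) U Xt z‖ ^ 2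
        ≤ 4 * (Fintype.card (T4AveragingDeficitWall.Plane 4) : ℝ) * (2 * ε) ^ 2 * Φ := by
          have hc : 0 ≤ 4 * (Fintype.card (T4AveragingDeficitWall.Plane 4) : ℝ) := by positivity
          calc _ ≤ 4 * (Fintype.card (T4AveragingDeficitWall.Plane 4) : ℝ) * (2 * ε) ^ 2 * ∑ z ∈ periodBox N, ‖framePotW L (j + 1) U Xt z‖ ^ 2 :=
                mul_le_mul_of_nonneg_right (mul_le_mul_of_nonneg_left h1 hc) h2
            _ ≤ _ := mul_le_mul_of_nonneg_left hΦ (by positivity)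
      _ = 16 * (Fintype.card (T4AveragingDeficitWall.Plane 4) : ℝ) * ε ^ 2 * Φ := by ring
  have hc0 : 0 ≤ 4 * Real.sqrt (Fintype.card (T4AveragingDeficitWall.Plane 4)) * ε * Real.sqrt Φ := by positivity
  calc Real.sqrt (∑ P ∈ perWin 4 N, nhsNormSq (frameComm L j U Xt P.1 P.2.1.1 P.2.1.2))
      ≤ Real.sqrt ((4 * Real.sqrt (Fintype.card (T4AveragingDeficitWall.Plane 4)) * ε * Real.sqrt Φ) ^ 2) := Real.sqrt_le_sqrt hb
    _ = 4 * Real.sqrt (Fintype.card (T4AveragingDeficitWall.Plane 4)) * ε * Real.sqrt Φ := Real.sqrt_sq hc0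

set_option maxHeartbeats 400000 in
/-- **SQUARED FORM** (Peter–Paul weight `θ′ > 0`): `Σ_P nhsNormSq (curl V₀ ṽ P) ≤ (1+θ′)·((1+θ)·hess + K·(L⁻¹)^{2(j+1)}·dirSq X̃) + (1+θ′⁻¹)·16·#planes·ε²·Φ`. [folklore] -/
theorem coarse_curl_le_of_frameLetter [Nonempty n] {L N : ℕ} [NeZero L] [NeZero N] (hL : 2 ≤ L) (hN : 1 ≤ N) {ε : ℝ} (hε : 0 ≤ ε)
    (hεD : 4 * ε * radD 4 L * (((L : ℝ) ^ 2)⁻¹) ^ 2 ≤ 1) (hεT : twoLevelSmall 4 L * (2 * ε * ((L : ℝ) ^ 2)⁻¹) ≤ 1)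
    (hεM : 8 * (L : ℝ) * mC 4 L (Fintype.card n) * ε * ((L : ℝ) ^ 2)⁻¹ ≤ 1) (j : ℕ)
    {U : Site 4 → Fin 4 → (Matrix n n ℂ)ˣ} (hU : IsUnitaryCfg U) (hUP : IsPeriodicCfg U ((tower L N (j + 1) : ℕ) : ℤ))
    (hUx : SmallField U (ε * (((L : ℝ) ^ 2)⁻¹) ^ (j + 1)))
    {X : TDir 4 n (L * tower L N j)} (hX : X ∈ skewSub 4 n (L * tower L N j)) {Φ : ℝ}
    (hΦ : ∑ z ∈ periodBox N, ‖framePotW L (j + 1) U (chartDir (ContinuousLinearMap.id ℝ (Matrix n n ℂ)) (L * tower L N j) X) z‖ ^ 2 ≤ Φ) {θ θ' : ℝ} (hθ : 0 < θ) (hθ' : 0 < θ') :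
    ∑ P ∈ perWin 4 N, nhsNormSq
        (curl (cavgIter L (j + 1) U) (chartDir (ContinuousLinearMap.id ℝ (Matrix n n ℂ)) N ((levelQ' L N j U X : ↥(skewSub 4 n N)) : TDir 4 n N)) P)
      ≤ (1 + θ') * ((1 + θ) * hess U (chartDir (ContinuousLinearMap.id ℝ (Matrix n n ℂ)) (L * tower L N j) X) (chartDir (ContinuousLinearMap.id ℝ (Matrix n n ℂ)) (L * tower L N j) X)
              (perWin 4 (tower L N (j + 1)))
          + ((1 + θ) * (14 * (Fintype.card (T4AveragingDeficitWall.Plane 4) : ℝ) * ε) + (1 + θ⁻¹) * (36 * eC 4 L (Fintype.card n) ^ 2 * ε ^ 2))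
            * ((L : ℝ)⁻¹) ^ (2 * (j + 1)) * dirSq (chartDir (ContinuousLinearMap.id ℝ (Matrix n n ℂ)) (L * tower L N j) X) (periodBox (tower L N (j + 1))))
        + (1 + θ'⁻¹) * (16 * (Fintype.card (T4AveragingDeficitWall.Plane 4) : ℝ) * ε ^ 2 * Φ) := by
  have h := sqrt_coarse_curl_le_of_frameLetter hL hN hε hεD hεT hεM j hU hUP hUx hX hΦ hθ
  have hΦ0 : 0 ≤ Φ := le_trans (Finset.sum_nonneg fun _ _ => sq_nonneg _) hΦ
  have hPl0 : (0 : ℝ) ≤ Fintype.card (T4AveragingDeficitWall.Plane 4) := Nat.cast_nonneg _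
  -- nonnegativity of F7's right side: it dominates a sum of squares
  have hF7 := frameCorrected_coarse_curl_le_hess hL hN hε hεD hεT hεM j hU hUP hUx hX hθ
  have hE0 : 0 ≤ (1 + θ) * hess U (chartDir (ContinuousLinearMap.id ℝ (Matrix n n ℂ)) (L * tower L N j) X) (chartDir (ContinuousLinearMap.id ℝ (Matrix n n ℂ)) (L * tower L N j) X)
              (perWin 4 (tower L N (j + 1)))
          + ((1 + θ) * (14 * (Fintype.card (T4AveragingDeficitWall.Plane 4) : ℝ) * ε) + (1 + θ⁻¹) * (36 * eC 4 L (Fintype.card n) ^ 2 * ε ^ 2))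
            * ((L : ℝ)⁻¹) ^ (2 * (j + 1)) * dirSq (chartDir (ContinuousLinearMap.id ℝ (Matrix n n ℂ)) (L * tower L N j) X) (periodBox (tower L N (j + 1))) :=
    le_trans (Finset.sum_nonneg fun _ _ => nhsNormSq_nonneg _) hF7
  have hx0 : 0 ≤ ∑ P ∈ perWin 4 N, nhsNormSq
      (curl (cavgIter L (j + 1) U) (chartDir (ContinuousLinearMap.id ℝ (Matrix n n ℂ)) N ((levelQ' L N j U X : ↥(skewSub 4 n N)) : TDir 4 n N)) P) :=
    Finset.sum_nonneg fun _ _ => nhsNormSq_nonneg _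
  have h' := h
  rw [show 4 * Real.sqrt (Fintype.card (T4AveragingDeficitWall.Plane 4)) * ε * Real.sqrt Φ
      = (4 * Real.sqrt (Fintype.card (T4AveragingDeficitWall.Plane 4)) * ε) * Real.sqrt Φ from by ring] at h'
  have hsq := sq_of_sqrt_le_add hx0 hE0 hΦ0 hθ' h'
  refine hsq.trans (le_of_eq ?_)
  congr 1
  rw [mul_pow, mul_pow, Real.sq_sqrt hPl0]
  ring

set_option maxHeartbeats 400000 in
/-- **F9 WITH A FRAME LETTER** (`d = 4`, j-UNIFORM): hypotheses of F9 ✓ `coarse_curl_le_hess_of_frameFree_poincare` with `hff` REPLACED by `Σ_{z∈periodBox N} ‖framePotW L (j+1) U X̃ z‖² ≤ Φ`;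
then for every `θ, θ′ > 0`, `K := (1+θ)·14·#planes·ε + (1+θ⁻¹)·36·eC²·ε²`:
`Σ_{P∈perWin N} nhsNormSq (curl V₀ ṽ P) ≤ (1+θ′)·(((1+θ) + 2K·C_P)·hess U X̃ X̃ (perWin 4 (tower L N (j+1))) + 2K·R) + (1+θ′⁻¹)·16·#planes·ε²·Φ`. [cite: Balaban1985Averaging, (48) p.25;
Balaban1985BackgroundPropagators, (3.10) p.391] -/
theorem coarse_curl_le_hess_of_frameLetter_poincare [Nonempty n] {L N : ℕ} [NeZero L] [NeZero N] (hL : 2 ≤ L) (hN : 1 ≤ N) {ε : ℝ} (hε : 0 ≤ ε)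
    (hεD : 4 * ε * radD 4 L * (((L : ℝ) ^ 2)⁻¹) ^ 2 ≤ 1) (hεT : twoLevelSmall 4 L * (2 * ε * ((L : ℝ) ^ 2)⁻¹) ≤ 1)
    (hεM : 8 * (L : ℝ) * mC 4 L (Fintype.card n) * ε * ((L : ℝ) ^ 2)⁻¹ ≤ 1) (j : ℕ)
    {U : Site 4 → Fin 4 → (Matrix n n ℂ)ˣ} (hU : IsUnitaryCfg U) (hUP : IsPeriodicCfg U ((tower L N (j + 1) : ℕ) : ℤ))
    (hUx : SmallField U (ε * (((L : ℝ) ^ 2)⁻¹) ^ (j + 1)))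
    {X : TDir 4 n (L * tower L N j)} (hX : X ∈ skewSub 4 n (L * tower L N j)) {Φ : ℝ}
    (hΦ : ∑ z ∈ periodBox N, ‖framePotW L (j + 1) U (chartDir (ContinuousLinearMap.id ℝ (Matrix n n ℂ)) (L * tower L N j) X) z‖ ^ 2 ≤ Φ)
    {CP R : ℝ} (hCP : 0 ≤ CP)
    (hP : ((L : ℝ)⁻¹) ^ (2 * (j + 1)) * dirSq (chartDir (ContinuousLinearMap.id ℝ (Matrix n n ℂ)) (L * tower L N j) X) (periodBox (tower L N (j + 1)))
      ≤ CP * ∑ p ∈ perWin 4 (tower L N (j + 1)), nhsNormSq (curl U (chartDir (ContinuousLinearMap.id ℝ (Matrix n n ℂ)) (L * tower L N j) X) p) + R)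
    (habs : 28 * (Fintype.card (T4AveragingDeficitWall.Plane 4) : ℝ) * ε * CP ≤ 1) {θ θ' : ℝ} (hθ : 0 < θ) (hθ' : 0 < θ') :
    ∑ P ∈ perWin 4 N, nhsNormSq
        (curl (cavgIter L (j + 1) U) (chartDir (ContinuousLinearMap.id ℝ (Matrix n n ℂ)) N ((levelQ' L N j U X : ↥(skewSub 4 n N)) : TDir 4 n N)) P)
      ≤ (1 + θ') * (((1 + θ) + 2 * ((1 + θ) * (14 * (Fintype.card (T4AveragingDeficitWall.Plane 4) : ℝ) * ε) + (1 + θ⁻¹) * (36 * eC 4 L (Fintype.card n) ^ 2 * ε ^ 2)) * CP)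
          * hess U (chartDir (ContinuousLinearMap.id ℝ (Matrix n n ℂ)) (L * tower L N j) X) (chartDir (ContinuousLinearMap.id ℝ (Matrix n n ℂ)) (L * tower L N j) X)
              (perWin 4 (tower L N (j + 1)))
          + 2 * ((1 + θ) * (14 * (Fintype.card (T4AveragingDeficitWall.Plane 4) : ℝ) * ε) + (1 + θ⁻¹) * (36 * eC 4 L (Fintype.card n) ^ 2 * ε ^ 2)) * R)
        + (1 + θ'⁻¹) * (16 * (Fintype.card (T4AveragingDeficitWall.Plane 4) : ℝ) * ε ^ 2 * Φ) := by
  have hT1 : 1 ≤ tower L N (j + 1) := Nat.one_le_iff_ne_zero.mpr (tower_ne_zero L N (j + 1))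
  have hXts : IsSkewDir (chartDir (ContinuousLinearMap.id ℝ (Matrix n n ℂ)) (L * tower L N j) X) := isSkewDir_chartDir_id hX
  have hXtP : IsPeriodicDir (chartDir (ContinuousLinearMap.id ℝ (Matrix n n ℂ)) (L * tower L N j) X) ((tower L N (j + 1) : ℕ) : ℤ) :=
    isPeriodicDir_chartDir (ContinuousLinearMap.id ℝ (Matrix n n ℂ)) (L * tower L N j) X
  obtain ⟨E₀, hE₀⟩ : ∃ E₀ : ℝ, E₀ = ∑ p ∈ perWin 4 (tower L N (j + 1)), nhsNormSq (curl U (chartDir (ContinuousLinearMap.id ℝ (Matrix n n ℂ)) (L * tower L N j) X) p) := ⟨_, rfl⟩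
  obtain ⟨S, hS⟩ : ∃ S : ℝ, S = dirSq (chartDir (ContinuousLinearMap.id ℝ (Matrix n n ℂ)) (L * tower L N j) X) (periodBox (tower L N (j + 1))) := ⟨_, rfl⟩
  obtain ⟨H, hH⟩ : ∃ H : ℝ, H = hess U (chartDir (ContinuousLinearMap.id ℝ (Matrix n n ℂ)) (L * tower L N j) X) (chartDir (ContinuousLinearMap.id ℝ (Matrix n n ℂ)) (L * tower L N j) X)
      (perWin 4 (tower L N (j + 1))) := ⟨_, rfl⟩
  obtain ⟨q2, hq2⟩ : ∃ q2 : ℝ, q2 = ((L : ℝ)⁻¹) ^ (2 * (j + 1)) := ⟨_, rfl⟩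
  obtain ⟨Pl, hPl⟩ : ∃ Pl : ℝ, Pl = (Fintype.card (T4AveragingDeficitWall.Plane 4) : ℝ) := ⟨_, rfl⟩
  obtain ⟨K, hK⟩ : ∃ K : ℝ, K = (1 + θ) * (14 * Pl * ε) + (1 + θ⁻¹) * (36 * eC 4 L (Fintype.card n) ^ 2 * ε ^ 2) := ⟨_, rfl⟩
  have hq20 : 0 ≤ q2 := by rw [hq2]; positivity
  have hPl0 : 0 ≤ Pl := by rw [hPl]; positivity
  have hS0 : 0 ≤ S := by rw [hS]; exact dirSq_nonneg _ _
  have hθ1 : 0 ≤ 1 + θ := by linarith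
  have hθ'1 : 0 ≤ 1 + θ' := by linarith
  have hK0 : 0 ≤ K := by rw [hK]; have := eC_nonneg 4 L (ν := (Fintype.card n : ℝ)); positivity
  -- the squared frame-letter form
  have hsq := coarse_curl_le_of_frameLetter hL hN hε hεD hεT hεM j hU hUP hUx hX hΦ hθ hθ'
  rw [← hH, ← hS, ← hq2, ← hPl, ← hK] at hsq
  -- the fine Hessian bounds the fine curl energy: E₀ ≤ H + 14·Pl·ε·q2·S
  have hqq : (((L : ℝ) ^ 2)⁻¹) ^ (j + 1) = q2 := by rw [hq2, inv_pow, inv_pow, ← pow_mul]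
  have hhess := hess_self_ge_nhs hU hXts hUx (perWin 4 (tower L N (j + 1)))
  rw [← hE₀, ← hH, hqq] at hhess
  have hbond := sum_bondSq_perWin_le (d := 4) hT1 hXtP
  rw [← hS, ← hPl] at hbond
  have hE₀le : E₀ ≤ H + 14 * Pl * ε * q2 * S := by
    have h7 : 0 ≤ 7 * (ε * q2) := by positivity
    have h8 := mul_le_mul_of_nonneg_left hbond h7
    have e1 : 7 * (ε * q2) * (2 * Pl * S) = 14 * Pl * ε * q2 * S := by ring
    rw [e1] at h8
    linarith
  -- the displayed Poincaré bound absorbed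
  rw [← hq2, ← hS, ← hE₀] at hP
  rw [← hPl] at habs
  have hmass : q2 * S ≤ 2 * CP * H + 2 * R := by
    have h0 := mul_le_mul_of_nonneg_left hE₀le hCP
    have h1 : q2 * S ≤ CP * (H + 14 * Pl * ε * q2 * S) + R := hP.trans (by linarith)
    have h2 : CP * (14 * Pl * ε) * (q2 * S) ≤ (1 / 2) * (q2 * S) := by
      have h3 : CP * (14 * Pl * ε) ≤ 1 / 2 := by linarith
      exact mul_le_mul_of_nonneg_right h3 (mul_nonneg hq20 hS0)
    have e : CP * (H + 14 * Pl * ε * q2 * S) = CP * H + CP * (14 * Pl * ε) * (q2 * S) := by ring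
    rw [e] at h1
    linarith
  -- assemble
  calc ∑ P ∈ perWin 4 N, nhsNormSq (curl (cavgIter L (j + 1) U) (chartDir (ContinuousLinearMap.id ℝ (Matrix n n ℂ)) N ((levelQ' L N j U X : ↥(skewSub 4 n N)) : TDir 4 n N)) P)
      ≤ (1 + θ') * ((1 + θ) * H + K * q2 * S) + (1 + θ'⁻¹) * (16 * Pl * ε ^ 2 * Φ) := hsq
    _ ≤ (1 + θ') * ((1 + θ) * H + K * (2 * CP * H + 2 * R)) + (1 + θ'⁻¹) * (16 * Pl * ε ^ 2 * Φ) := by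
        have h1 : K * q2 * S ≤ K * (2 * CP * H + 2 * R) := by rw [mul_assoc]; exact mul_le_mul_of_nonneg_left hmass hK0
        have h2 := mul_le_mul_of_nonneg_left h1 hθ'1
        linarith
    _ = (1 + θ') * (((1 + θ) + 2 * K * CP) * H + 2 * K * R) + (1 + θ'⁻¹) * (16 * Pl * ε ^ 2 * Φ) := by ring
    _ = _ := by rw [hK, hPl, hH]

end

end Summit.QuantumFields.BalabanUV.T4Continuum.NE7CoarseCurlFrameLetter
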